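import Literature.NumberTheory.Sieve.Maynard2016PrimeCounts
import Literature.NumberTheory.Sieve.Maynard2016Inputs
import Literature.NumberTheory.Sieve.SieveFrameworkFundamentalLemma
import Literature.NumberTheory.Sieve.SieveFrameworkProofs
import Literature.NumberTheory.Sieve.ChenSiftedLower
import HarnessLib

/-!
# Maynard (2016), *Large gaps between primes* — Lemma 3, PROVED

J. Maynard, *Large gaps between primes*, Compositio Math. 152 (2016), §2, Lemma 3
[Maynard2016LargeGaps]: for `0 < ε` small, all large `x`, all `z + z/log x ≤ V ≤ x log² x` and all
`m ≤ x`,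
`#{z < p ≤ V : (mp − 1, P_y) = 1} = (V − z)/log x · 𝔖_y(m) · (1 + O(e^{−√(log₂ x)}))`,
`𝔖_y(m) = ∏_{p ≤ y, p ∤ m} (p − 2)/(p − 1)` — the named fact
`Literature.NumberTheory.Sieve.Maynard2016.Lemma3` of `Maynard2016LargeGapsStatements.lean`, proved here
(`lemma3_holds`) exactly as in the paper: "The lemma now follows from the fundamental lemma of sieve
methods … combined with the Bombieri–Vinogradov theorem and the prime number theorem", with every
input a PROVED result of the tree:

* the fundamental lemma, uniform form (`SieveSequence.fundamental_lemma_uniform_holds`,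
  Friedlander–Iwaniec Cor. 6.10), applied to the sifted sequence `𝒜 = {mp − 1 : z < p ≤ V}` of
  dimension one (density `g(d) = 1/φ(d)` for `(d, m) = 1`, `0` otherwise — the shifted-primes density
  `shiftedPrimesDensity m`, whose dimension-`1` constant is uniform in even `m` by comparison with
  `h = 2`, `hasSieveDimension_shiftedPrimes_one_holds`), sifting level `P(y + 1) = P_y`,
  `D = ⌊z⌋^{1/4}`, so that `s = log D/log y ≫ log₂ x/log₃ x` and `e^{−s} = o(e^{−√(log₂ x)})`;
* Bombieri–Vinogradov in the `π`-form for one residue per modulus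
  (`Chen.eventually_sum_abs_primeCountingDisc_le` with `BombieriVinogradovStatement_holds`): the remainder
  `R_d = (π(V; d, m̄) − π(V)/φ(d)) − (π(z; d, m̄) − π(z)/φ(d))` (`m m̄ ≡ 1 (mod d)`) summed over
  `d ≤ ⌊z⌋^{1/4}` is `≪ x log² x/(log z)^8 = o(e^{−√(log₂ x)} (V − z)/log x · 𝔖_y(m))`, using
  `𝔖_y(m) ≥ P_y ≥ 1/(4 log² y)` (`oddPrimeProd_ge`, Mertens);
* the prime number theorem with de la Vallée Poussin's error term for the main term
  `X = #{z < p ≤ V} = (V − z)/log x (1 + O(e^{−√(log₂ x)}/4))` (`Maynard2016.eventually_card_primes_Ioc`).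

For odd `m` both sides vanish (`sievedPrimes_eq_empty_of_odd`; the factor `p = 2` of `𝔖_y(m)`).
Consequently the chain `Lemma 2 ∧ Lemma 3 ∧ GPYMeasures ⇒ Theorem 1` of `Maynard2016Inputs.lean` has
exactly two named inputs left (`theorem1_of_lemma2_GPY`).
-/

open Finset Filter Real Topology

noncomputable section

namespace Literature.NumberTheory.Sieve

namespace Maynard2016

/-! ### The sifted sequence of Lemma 3: `𝒜 = {mp − 1 : z < p ≤ V}` -/

/-- The shifted set `{mp − 1 : N_z < p ≤ N_V, p prime}` (`N_z = ⌊z⌋`, `N_V = ⌊V⌋`).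
[cite: Maynard2016LargeGaps, §2, proof of Lemma 3] -/
def lemma3Set (m Nz NV : ℕ) : Finset ℕ :=
  ((Finset.Ioc Nz NV).filter Nat.Prime).image (fun p => m * p - 1)

/-- The weights `a(n) = 1_{𝒜}(n)` of the sifted sequence of Lemma 3. [cite: Maynard2016LargeGaps, §2, proof of Lemma 3] -/
def lemma3Weight (m Nz NV : ℕ) (n : ℕ) : ℝ :=
  if n ∈ lemma3Set m Nz NV then 1 else 0

/-- `0 ≤ a(n)`. [folklore] -/
private theorem lemma3Weight_nonneg (m Nz NV n : ℕ) : 0 ≤ lemma3Weight m Nz NV n := by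
  unfold lemma3Weight; split_ifs <;> norm_num

/-- **The sifted sequence of Lemma 3**: `a = 1_{𝒜}`, `𝒜 = {mp − 1 : z < p ≤ V}`, expected size
`X = #{z < p ≤ V}` (constant in the height), density `g(d) = 1/φ(d)` for `(d, m) = 1` and `0`
otherwise (`shiftedPrimesDensity m`: "`mp − 1 ≡ 0 (mod d)` puts `p` in one reduced class when
`(d, m) = 1` and in none otherwise"). [cite: Maynard2016LargeGaps, §2, proof of Lemma 3] -/
def lemma3Seq (m Nz NV : ℕ) : SieveSequence where
  a := lemma3Weight m Nz NV
  a_nonneg := lemma3Weight_nonneg m Nz NV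
  size := fun _ => (((Finset.Ioc Nz NV).filter Nat.Prime).card : ℝ)
  density := shiftedPrimesDensity m
  density_mult := isMultiplicative_shiftedPrimesDensity m

/-- `∑_{n ∈ s} a(n) = #(s ∩ 𝒜)`. [folklore] -/
private theorem sum_lemma3Weight (m Nz NV : ℕ) (s : Finset ℕ) :
    ∑ n ∈ s, lemma3Weight m Nz NV n = #(s.filter fun n => n ∈ lemma3Set m Nz NV) := by
  classical
  rw [Finset.card_filter, Nat.cast_sum]
  refine Finset.sum_congr rfl fun n _ => ?_
  unfold lemma3Weight
  split_ifs <;> simp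

/-- `p ↦ mp − 1` is injective on positive `p` (for `m ≥ 1`). [folklore] -/
private theorem mul_sub_one_injOn {m : ℕ} (hm : 1 ≤ m) (s : Finset ℕ) (hs : ∀ p ∈ s, 1 ≤ p) :
    Set.InjOn (fun p : ℕ => m * p - 1) (s : Set ℕ) := by
  intro p hp q hq h
  have hp1 : 0 < m * p := Nat.mul_pos (by omega) (hs p (Finset.mem_coe.1 hp))
  have hq1 : 0 < m * q := Nat.mul_pos (by omega) (hs q (Finset.mem_coe.1 hq))
  simp only at h
  have hmul : m * p = m * q := by omega
  exact Nat.eq_of_mul_eq_mul_left (by omega) hmul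

/-- `𝒜 ⊆ (0, m N_V]`. [folklore] -/
private theorem lemma3Set_subset {m Nz NV : ℕ} (hm : 1 ≤ m) :
    lemma3Set m Nz NV ⊆ Finset.Ioc 0 (m * NV) := by
  intro n hn
  rw [lemma3Set, Finset.mem_image] at hn
  obtain ⟨p, hp, rfl⟩ := hn
  rw [Finset.mem_filter, Finset.mem_Ioc] at hp
  simp only [Finset.mem_Ioc]
  have h1 : 2 ≤ m * p := le_trans hp.2.two_le (Nat.le_mul_of_pos_left p (by omega))
  have h2 : m * p ≤ m * NV := Nat.mul_le_mul_left m hp.1.2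
  omega

/-- **`S(𝒜, P; mN_V) = #{N_z < p ≤ N_V : (mp − 1, P) = 1}`** for every sifting range `P`.
[cite: Maynard2016LargeGaps, §2, proof of Lemma 3] -/
theorem sifted_lemma3Seq_eq {m Nz NV : ℕ} (hm : 1 ≤ m) (P : ℕ) :
    (lemma3Seq m Nz NV).sifted ((m * NV : ℕ) : ℝ) P =
      #(((Finset.Ioc Nz NV).filter Nat.Prime).filter (fun p => (m * p - 1).Coprime P)) := by
  classical
  rw [SieveSequence.sifted, Nat.floor_natCast]
  change ∑ n ∈ (Ioc 0 (m * NV)).filter (fun n : ℕ => n.Coprime P), lemma3Weight m Nz NV n = _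
  rw [sum_lemma3Weight]
  have h1 : ((Ioc 0 (m * NV)).filter (fun n : ℕ => n.Coprime P)).filter
      (fun n => n ∈ lemma3Set m Nz NV) = (lemma3Set m Nz NV).filter (fun n => n.Coprime P) := by
    ext n
    simp only [Finset.mem_filter]
    constructor
    · rintro ⟨⟨-, h⟩, h'⟩
      exact ⟨h', h⟩
    · rintro ⟨h, h'⟩
      exact ⟨⟨lemma3Set_subset hm h, h'⟩, h⟩
  rw [h1, lemma3Set, Finset.filter_image, Finset.card_image_of_injOn]
  exact mul_sub_one_injOn hm _ fun p hp =>
    (Finset.mem_filter.1 (Finset.mem_filter.1 hp).1).2.one_le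

/-- The counting set of Lemma 3 as a filter of the primes in `(⌊z⌋, ⌊V⌋]`. [cite: Maynard2016LargeGaps, Lemma 3] -/
theorem sievedPrimes_eq_filter (ε : ℝ) (x : ℕ) (V : ℝ) (m : ℕ) :
    sievedPrimes ε x V m = ((Finset.Ioc ⌊z x⌋₊ ⌊V⌋₊).filter Nat.Prime).filter
      (fun p => (m * p - 1).Coprime (primorial ⌊y ε x⌋₊)) := by
  ext p
  simp only [sievedPrimes, Finset.mem_filter, Finset.mem_Icc, Finset.mem_Ioc]
  constructor
  · rintro ⟨⟨-, hV⟩, hp, hz, hc⟩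
    exact ⟨⟨⟨(Nat.floor_lt' hp.ne_zero).2 hz, hV⟩, hp⟩, hc⟩
  · rintro ⟨⟨⟨hz, hV⟩, hp⟩, hc⟩
    exact ⟨⟨hp.one_le, hV⟩, hp, (Nat.floor_lt' hp.ne_zero).1 hz, hc⟩

/-- **`#{z < p ≤ V : (mp − 1, P_y) = 1} = S(𝒜, P_y; m⌊V⌋)`.** [cite: Maynard2016LargeGaps, §2, proof of Lemma 3] -/
theorem card_sievedPrimes_eq (ε : ℝ) (x : ℕ) (V : ℝ) {m : ℕ} (hm : 1 ≤ m) :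
    ((sievedPrimes ε x V m).card : ℝ) =
      (lemma3Seq m ⌊z x⌋₊ ⌊V⌋₊).sifted ((m * ⌊V⌋₊ : ℕ) : ℝ) (primorial ⌊y ε x⌋₊) := by
  rw [sifted_lemma3Seq_eq hm, sievedPrimes_eq_filter]

/-- **`V(P_Y) = ∏_{p ≤ Y, p ∤ m} (p − 2)/(p − 1)`** for the density `g = 1_{(d,m)=1}/φ`:
`1 − g(p) = 1` for `p ∣ m` and `= 1 − 1/(p − 1)` for `p ∤ m`. [cite: Maynard2016LargeGaps, §2, proof of Lemma 3] -/
theorem densityProduct_lemma3Seq_primorial (m Nz NV Y : ℕ) :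
    (lemma3Seq m Nz NV).densityProduct (primorial Y) =
      ∏ p ∈ (Finset.Iic Y).filter (fun p => p.Prime ∧ ¬ p ∣ m), ((p : ℝ) - 2) / ((p : ℝ) - 1) := by
  rw [SieveSequence.densityProduct, ← primesProdBelow_natCast_add_one, primeFactors_primesProdBelow,
    Nat.ceil_natCast]
  change ∏ p ∈ Nat.primesBelow (Y + 1), (1 - shiftedPrimesDensity m p) = _
  have hset : (Finset.Iic Y).filter (fun p => p.Prime ∧ ¬ p ∣ m) =
      (Nat.primesBelow (Y + 1)).filter (fun p => ¬ p ∣ m) := by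
    ext p
    simp only [Finset.mem_filter, Finset.mem_Iic, Nat.mem_primesBelow, Nat.lt_succ_iff, and_assoc]
  rw [hset, Finset.prod_filter]
  refine Finset.prod_congr rfl fun p hp => ?_
  have hpp : p.Prime := (Nat.mem_primesBelow.1 hp).2
  rw [shiftedPrimesDensity_apply]
  by_cases hdvd : p ∣ m
  · rw [if_neg (fun h => ((Nat.Prime.coprime_iff_not_dvd hpp).1 h.1) hdvd), if_neg (not_not.2 hdvd),
      sub_zero]
  · rw [if_pos ⟨(Nat.Prime.coprime_iff_not_dvd hpp).2 hdvd, hpp.ne_zero⟩, if_pos hdvd,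
      Nat.totient_prime hpp, Nat.cast_pred hpp.pos]
    have h2 : (2 : ℝ) ≤ p := by exact_mod_cast hpp.two_le
    have h1 : (p : ℝ) - 1 ≠ 0 := by
      have : (0 : ℝ) < p - 1 := by linarith
      exact this.ne'
    field_simp
    ring

/-- **`V(P_y) = 𝔖_y(m)`.** [cite: Maynard2016LargeGaps, §2, proof of Lemma 3] -/
theorem densityProduct_lemma3Seq_eq (ε : ℝ) (x : ℕ) (m Nz NV : ℕ) :
    (lemma3Seq m Nz NV).densityProduct (primorial ⌊y ε x⌋₊) = singProd ε x m :=
  densityProduct_lemma3Seq_primorial m Nz NV _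

/-! ### Congruence sums and remainders: `A_d = π(V; d, m̄) − π(z; d, m̄)` -/

/-- `d ∣ mp − 1 ⟺ p ≡ m̄ (mod d)` for `(m, d) = 1`, with `m̄ = (Chen.resUnit m d)⁻¹`. [folklore] -/
private theorem dvd_mul_sub_one_iff {m p d : ℕ} (hmp : 1 ≤ m * p) (hmd : m.Coprime d) :
    d ∣ m * p - 1 ↔ ((p : ℕ) : ZMod d) = (((Chen.resUnit m d)⁻¹ : (ZMod d)ˣ) : ZMod d) := by
  rw [← ZMod.natCast_eq_zero_iff, Nat.cast_sub hmp, Nat.cast_mul, Nat.cast_one, sub_eq_zero,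
    ← Chen.coe_resUnit hmd]
  constructor
  · intro h
    calc (p : ZMod d) = ((Chen.resUnit m d)⁻¹ : (ZMod d)ˣ) * ((Chen.resUnit m d : ZMod d) * p) :=
          (Units.inv_mul_cancel_left _ _).symm
      _ = _ := by rw [h, mul_one]
  · intro h
    rw [h, Units.mul_inv]

/-- `A_d(m N_V) = #{N_z < p ≤ N_V : d ∣ mp − 1}`. [cite: Maynard2016LargeGaps, §2, proof of Lemma 3] -/
theorem congrSum_lemma3Seq_eq {m Nz NV : ℕ} (hm : 1 ≤ m) (d : ℕ) :
    (lemma3Seq m Nz NV).congrSum d ((m * NV : ℕ) : ℝ) =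
      #(((Finset.Ioc Nz NV).filter Nat.Prime).filter (fun p => d ∣ m * p - 1)) := by
  classical
  rw [SieveSequence.congrSum, Nat.floor_natCast]
  change ∑ n ∈ (Ioc 0 (m * NV)).filter (d ∣ ·), lemma3Weight m Nz NV n = _
  rw [sum_lemma3Weight]
  have h1 : ((Ioc 0 (m * NV)).filter (d ∣ ·)).filter (fun n => n ∈ lemma3Set m Nz NV) =
      (lemma3Set m Nz NV).filter (fun n => d ∣ n) := by
    ext n
    simp only [Finset.mem_filter]
    constructor
    · rintro ⟨⟨-, h⟩, h'⟩
      exact ⟨h', h⟩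
    · rintro ⟨h, h'⟩
      exact ⟨⟨lemma3Set_subset hm h, h'⟩, h⟩
  rw [h1, lemma3Set, Finset.filter_image, Finset.card_image_of_injOn]
  exact mul_sub_one_injOn hm _ fun p hp =>
    (Finset.mem_filter.1 (Finset.mem_filter.1 hp).1).2.one_le

/-- `#{N_z < p ≤ N_V prime} = π(N_V) − π(N_z)`. [folklore] -/
private theorem card_primes_Ioc_eq {Nz NV : ℕ} (hNzV : Nz ≤ NV) :
    (#((Finset.Ioc Nz NV).filter Nat.Prime) : ℝ) =
      (Nat.primeCounting NV : ℝ) - Nat.primeCounting Nz := by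
  have hsplit : Nat.primesLE NV = Nat.primesLE Nz ∪ (Finset.Ioc Nz NV).filter Nat.Prime := by
    rw [Nat.primesLE_eq_filter_range, Nat.primesLE_eq_filter_range, ← Finset.filter_union]
    congr 1
    ext p
    simp only [Finset.mem_union, Finset.mem_range, Finset.mem_Ioc]
    omega
  have hdisj : Disjoint (Nat.primesLE Nz) ((Finset.Ioc Nz NV).filter Nat.Prime) := by
    rw [Nat.primesLE_eq_filter_range]
    exact Finset.disjoint_filter_filter (Finset.disjoint_left.2 fun p h1 h2 => by
      rw [Finset.mem_range] at h1
      rw [Finset.mem_Ioc] at h2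
      omega)
  rw [← Nat.primesLE_card_eq_primeCounting, ← Nat.primesLE_card_eq_primeCounting, hsplit,
    Finset.card_union_of_disjoint hdisj, Nat.cast_add]
  ring

/-- **`A_d(mN_V) = π(N_V; d, m̄) − π(N_z; d, m̄)` for `(d, m) = 1`.** [cite: Maynard2016LargeGaps, §2, proof of Lemma 3] -/
theorem congrSum_lemma3Seq_eq_card_sub {m Nz NV d : ℕ} (hm : 1 ≤ m) (hNzV : Nz ≤ NV)
    (hmd : m.Coprime d) :
    (lemma3Seq m Nz NV).congrSum d ((m * NV : ℕ) : ℝ) =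
      (#{p ∈ range (NV + 1) | p.Prime ∧
          ((p : ℕ) : ZMod d) = (((Chen.resUnit m d)⁻¹ : (ZMod d)ˣ) : ZMod d)} : ℝ) -
        #{p ∈ range (Nz + 1) | p.Prime ∧
          ((p : ℕ) : ZMod d) = (((Chen.resUnit m d)⁻¹ : (ZMod d)ˣ) : ZMod d)} := by
  classical
  rw [congrSum_lemma3Seq_eq hm]
  set a : ZMod d := (((Chen.resUnit m d)⁻¹ : (ZMod d)ˣ) : ZMod d) with ha
  have hT : ((Finset.Ioc Nz NV).filter Nat.Prime).filter (fun p => d ∣ m * p - 1) =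
      (Finset.Ioc Nz NV).filter (fun p => p.Prime ∧ ((p : ℕ) : ZMod d) = a) := by
    ext p
    simp only [Finset.mem_filter, and_assoc]
    refine and_congr_right fun _ => and_congr_right fun hpp => ?_
    exact dvd_mul_sub_one_iff (Nat.mul_pos (by omega) hpp.pos) hmd
  have hsplit : (range (NV + 1)).filter (fun p => p.Prime ∧ ((p : ℕ) : ZMod d) = a) =
      (range (Nz + 1)).filter (fun p => p.Prime ∧ ((p : ℕ) : ZMod d) = a) ∪
        (Finset.Ioc Nz NV).filter (fun p => p.Prime ∧ ((p : ℕ) : ZMod d) = a) := by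
    rw [← Finset.filter_union]
    congr 1
    ext p
    simp only [Finset.mem_union, Finset.mem_range, Finset.mem_Ioc]
    omega
  have hdisj : Disjoint ((range (Nz + 1)).filter (fun p => p.Prime ∧ ((p : ℕ) : ZMod d) = a))
      ((Finset.Ioc Nz NV).filter (fun p => p.Prime ∧ ((p : ℕ) : ZMod d) = a)) :=
    Finset.disjoint_filter_filter (Finset.disjoint_left.2 fun p h1 h2 => by
      rw [Finset.mem_range] at h1
      rw [Finset.mem_Ioc] at h2
      omega)
  rw [hT, hsplit, Finset.card_union_of_disjoint hdisj, Nat.cast_add]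
  ring

/-- **`R_d(mN_V) = δ(N_V; d, m̄) − δ(N_z; d, m̄)`** (`δ(N; d, a) = π(N; d, a) − π(N)/φ(d)`) for
`(d, m) = 1`, `d ≠ 0`. [cite: Maynard2016LargeGaps, §2, proof of Lemma 3] -/
theorem remainder_lemma3Seq_eq {m Nz NV d : ℕ} (hm : 1 ≤ m) (hNzV : Nz ≤ NV) (hd : d ≠ 0)
    (hmd : m.Coprime d) :
    (lemma3Seq m Nz NV).remainder d ((m * NV : ℕ) : ℝ) =
      primeCountingDisc d (((Chen.resUnit m d)⁻¹ : (ZMod d)ˣ) : ZMod d) NV -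
        primeCountingDisc d (((Chen.resUnit m d)⁻¹ : (ZMod d)ˣ) : ZMod d) Nz := by
  rw [SieveSequence.remainder, congrSum_lemma3Seq_eq_card_sub hm hNzV hmd,
    Chen.primeCountingDisc_eq_card_sub, Chen.primeCountingDisc_eq_card_sub]
  change _ - shiftedPrimesDensity m d * (#((Finset.Ioc Nz NV).filter Nat.Prime) : ℝ) = _
  rw [card_primes_Ioc_eq hNzV, shiftedPrimesDensity_apply, if_pos ⟨hmd.symm, hd⟩, div_eq_mul_inv,
    div_eq_mul_inv]
  ring

/-- `R_d(mN_V) = 0` when `(d, m) ≠ 1` or `d = 0`: no `mp − 1` is divisible by `d`, and `g(d) = 0`.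
[cite: Maynard2016LargeGaps, §2, proof of Lemma 3] -/
theorem remainder_lemma3Seq_eq_zero {m Nz NV d : ℕ} (hm : 1 ≤ m) (hmd : ¬ (m.Coprime d ∧ d ≠ 0)) :
    (lemma3Seq m Nz NV).remainder d ((m * NV : ℕ) : ℝ) = 0 := by
  classical
  rw [SieveSequence.remainder, congrSum_lemma3Seq_eq hm]
  change _ - shiftedPrimesDensity m d * _ = (0 : ℝ)
  rw [shiftedPrimesDensity_apply, if_neg (fun h => hmd ⟨h.1.symm, h.2⟩), zero_mul, sub_zero,
    Nat.cast_eq_zero, Finset.card_eq_zero, Finset.filter_eq_empty_iff]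
  intro p hp hdvd
  have hpp : p.Prime := (Finset.mem_filter.1 hp).2
  have hmp : 2 ≤ m * p := le_trans hpp.two_le (Nat.le_mul_of_pos_left p (by omega))
  apply hmd
  refine ⟨?_, ?_⟩
  · show Nat.gcd m d = 1
    have h1 : Nat.gcd m d ∣ m * p - 1 := (Nat.gcd_dvd_right m d).trans hdvd
    have h2 : Nat.gcd m d ∣ m * p := (Nat.gcd_dvd_left m d).trans (Nat.dvd_mul_right m p)
    have h3 : Nat.gcd m d ∣ m * p - (m * p - 1) := Nat.dvd_sub h2 h1
    rw [Nat.sub_sub_self (by omega : 1 ≤ m * p)] at h3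
    exact Nat.dvd_one.1 h3
  · rintro rfl
    rw [zero_dvd_iff] at hdvd
    omega

/-- A choice of the residue `m̄ = m⁻¹ (mod q)` as a unit, for every modulus `q` (junk `1` when
`(m, q) ≠ 1`). [folklore] -/
def lemma3Residue (m : ℕ) (q : ℕ) : (ZMod q)ˣ := (Chen.resUnit m q)⁻¹

/-- **`|R_d(mN_V)| ≤ |δ(N_V; d, m̄)| + |δ(N_z; d, m̄)|` for every `d`.** [cite: Maynard2016LargeGaps, §2, proof of Lemma 3] -/
theorem abs_remainder_lemma3Seq_le {m Nz NV : ℕ} (hm : 1 ≤ m) (hNzV : Nz ≤ NV) (d : ℕ) :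
    |(lemma3Seq m Nz NV).remainder d ((m * NV : ℕ) : ℝ)| ≤
      |primeCountingDisc d (lemma3Residue m d : ZMod d) NV| +
        |primeCountingDisc d (lemma3Residue m d : ZMod d) Nz| := by
  by_cases h : m.Coprime d ∧ d ≠ 0
  · rw [remainder_lemma3Seq_eq hm hNzV h.2 h.1]
    exact abs_sub _ _
  · rw [remainder_lemma3Seq_eq_zero hm h, abs_zero]
    positivity

/-- **The remainder sum of the fundamental lemma is dominated by two Bombieri–Vinogradov sums**:
`∑_{d ∣ P, d ≤ D} |R_d| ≤ ∑_{d ≤ D} |δ(N_V; d, m̄)| + ∑_{d ≤ D} |δ(N_z; d, m̄)|`.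
[cite: Maynard2016LargeGaps, §2, proof of Lemma 3] -/
theorem remainderSum_lemma3Seq_le {m Nz NV : ℕ} (hm : 1 ≤ m) (hNzV : Nz ≤ NV) (P : ℕ) (D : ℝ) :
    ∑ d ∈ P.divisors.filter (fun d : ℕ => (d : ℝ) ≤ D),
        |(lemma3Seq m Nz NV).remainder d ((m * NV : ℕ) : ℝ)| ≤
      ∑ d ∈ Finset.Icc 1 ⌊D⌋₊, |primeCountingDisc d (lemma3Residue m d : ZMod d) NV| +
        ∑ d ∈ Finset.Icc 1 ⌊D⌋₊, |primeCountingDisc d (lemma3Residue m d : ZMod d) Nz| := by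
  have hsub : P.divisors.filter (fun d : ℕ => (d : ℝ) ≤ D) ⊆ Finset.Icc 1 ⌊D⌋₊ := by
    intro d hd
    rw [Finset.mem_filter, Nat.mem_divisors] at hd
    rw [Finset.mem_Icc]
    exact ⟨Nat.pos_of_dvd_of_pos hd.1.1 (Nat.pos_of_ne_zero hd.1.2), Nat.le_floor hd.2⟩
  calc ∑ d ∈ P.divisors.filter (fun d : ℕ => (d : ℝ) ≤ D),
        |(lemma3Seq m Nz NV).remainder d ((m * NV : ℕ) : ℝ)|
      ≤ ∑ d ∈ P.divisors.filter (fun d : ℕ => (d : ℝ) ≤ D),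
          (|primeCountingDisc d (lemma3Residue m d : ZMod d) NV| +
            |primeCountingDisc d (lemma3Residue m d : ZMod d) Nz|) :=
        Finset.sum_le_sum fun d _ => abs_remainder_lemma3Seq_le hm hNzV d
    _ ≤ ∑ d ∈ Finset.Icc 1 ⌊D⌋₊,
          (|primeCountingDisc d (lemma3Residue m d : ZMod d) NV| +
            |primeCountingDisc d (lemma3Residue m d : ZMod d) Nz|) :=
        Finset.sum_le_sum_of_subset_of_nonneg hsub fun d _ _ => by positivity
    _ = _ := Finset.sum_add_distrib

/-! ### Dimension one, uniformly in even `m` -/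

/-- For even `m` and prime `p`: `0 ≤ g_m(p) ≤ g_2(p) < 1` (`g_m(p) = 1/(p−1)` or `0`; `g_m(2) = 0`).
[folklore] -/
private theorem shiftedPrimesDensity_le_two {m : ℕ} (hm : Even m) {p : ℕ} (hp : p.Prime) :
    0 ≤ shiftedPrimesDensity m p ∧ shiftedPrimesDensity m p ≤ shiftedPrimesDensity 2 p ∧
      shiftedPrimesDensity 2 p < 1 := by
  rw [shiftedPrimesDensity_apply, shiftedPrimesDensity_apply]
  have hφ : (0 : ℝ) ≤ ((Nat.totient p : ℝ))⁻¹ := by positivity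
  by_cases h2 : p.Coprime 2 ∧ p ≠ 0
  · rw [if_pos h2]
    have hp2 : p ≠ 2 := by
      rintro rfl
      exact absurd h2.1 (by decide)
    have hp3 : 3 ≤ p := by have := hp.two_le; omega
    have hlt : ((Nat.totient p : ℝ))⁻¹ < 1 := by
      rw [Nat.totient_prime hp, Nat.cast_pred hp.pos]
      have : (3 : ℝ) ≤ p := by exact_mod_cast hp3
      exact inv_lt_one_of_one_lt₀ (by linarith)
    refine ⟨?_, ?_, hlt⟩
    · split_ifs
      · exact hφ
      · exact le_rfl
    · split_ifs
      · exact le_rfl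
      · exact hφ
  · rw [if_neg h2]
    have hp2 : p = 2 := by
      by_contra hne
      exact h2 ⟨(Nat.coprime_primes hp Nat.prime_two).2 hne, hp.ne_zero⟩
    subst hp2
    have hn : ¬ ((2 : ℕ).Coprime m ∧ (2 : ℕ) ≠ 0) := fun h =>
      ((Nat.Prime.coprime_iff_not_dvd Nat.prime_two).1 h.1) (even_iff_two_dvd.1 hm)
    rw [if_neg hn]
    exact ⟨le_rfl, le_rfl, zero_lt_one⟩

/-- **Dimension `1` uniformly in even `m`**: a dimension-`1` constant `K` for `g_2 = 1_{odd}/φ` serves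
for every `g_m = 1_{(·,m)=1}/φ`, `m` even, since `(1 − g_m(p))⁻¹ ≤ (1 − g_2(p))⁻¹` termwise.
[cite: HalberstamRichert1974, Ch. 2 Lemma 2.4 (κ = 1)] -/
theorem hasSieveDimension_shiftedPrimesDensity_of_even {K : ℝ}
    (hK : HasSieveDimension (shiftedPrimesDensity 2) 1 K) {m : ℕ} (hm : Even m) :
    HasSieveDimension (shiftedPrimesDensity m) 1 K := by
  refine ⟨fun p hp => ?_, fun w u hw hwu => ?_⟩
  · obtain ⟨h0, hle, hlt⟩ := shiftedPrimesDensity_le_two hm hp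
    exact ⟨h0, hle.trans_lt hlt⟩
  · refine le_trans (Finset.prod_le_prod (fun p hp => ?_) (fun p hp => ?_)) (hK.2 w u hw hwu)
    · have hpp := Nat.prime_of_mem_primesBelow (Finset.mem_filter.1 hp).1
      obtain ⟨h0, hle, hlt⟩ := shiftedPrimesDensity_le_two hm hpp
      exact inv_nonneg.2 (by linarith)
    · have hpp := Nat.prime_of_mem_primesBelow (Finset.mem_filter.1 hp).1
      obtain ⟨h0, hle, hlt⟩ := shiftedPrimesDensity_le_two hm hpp
      exact inv_anti₀ (by linarith) (by linarith)

/-- There is ONE constant `K` with `Ω(1)` for every `g_m`, `m` even. [cite: HalberstamRichert1974, Ch. 2 Lemma 2.4 (κ = 1)] -/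
theorem exists_hasSieveDimension_uniform :
    ∃ K : ℝ, ∀ m : ℕ, Even m → HasSieveDimension (shiftedPrimesDensity m) 1 K := by
  obtain ⟨K, hK⟩ := hasSieveDimension_shiftedPrimes_one_holds (h := 2) even_two
  rw [SieveSequence.shiftedPrimes_density] at hK
  exact ⟨K, fun m hm => hasSieveDimension_shiftedPrimesDensity_of_even hK hm⟩


/-! ### The numerical combination of the three inputs -/

/-- **The arithmetic of Lemma 3.** With `M = X₀ W` the main term (`X₀ = (V − z)/log x`,
`W = 𝔖_y(m) ≥ 1/(4 log² x)`), `E = e^{−√(log₂ x)} ≥ 1/log x`: the fundamental-lemma error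
`C X W e^{−s} ≤ (5C e^{−s}/4) M ≤ (E/4) M`, the main-term error `|X − X₀| W ≤ (E/4) M`, and the two
Bombieri–Vinogradov sums `≤ 2^9 C' x/(log x)^6 ≤ (E/2) M` (as `M ≥ x/(4 log₂ x (log x)^4)` and
`2^{12} C' log₂ x ≤ log x`) add up to `E M`. [cite: Maynard2016LargeGaps, §2, proof of Lemma 3] -/
theorem lemma3_numeric {Pc X X₀ W E es R SV Sz C_FL C_BV L L₂ xr zr Nz NV V lNz lNV : ℝ}
    (hFLA : |Pc - X * W| ≤ C_FL * X * W * es + R) (hR : R ≤ SV + Sz)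
    (hSV : SV ≤ C_BV * NV / lNV ^ 8) (hSz : Sz ≤ C_BV * Nz / lNz ^ 8)
    (hX : |X - X₀| ≤ E / 4 * X₀) (hX₀ : X₀ = (V - zr) / L)
    (hVlo : zr + zr / L ≤ V) (hVhi : V ≤ xr * L ^ 2)
    (hW0 : 0 ≤ W) (hW : 1 / (4 * L ^ 2) ≤ W)
    (hCFL : 0 ≤ C_FL) (hes : 0 ≤ es) (hFLexp : 5 * C_FL * es ≤ E)
    (hE1 : E ≤ 1) (hEL : 1 / L ≤ E)
    (hL : 1 ≤ L) (hL₂ : 1 ≤ L₂) (hz : zr = xr / L₂) (hz0 : 0 < zr)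
    (hNV : NV ≤ V) (hNz : Nz ≤ zr)
    (hlNz : L / 2 ≤ lNz) (hlNV : lNz ≤ lNV)
    (hCBV : 0 ≤ C_BV) (hBVnum : 4096 * C_BV * L₂ ≤ L) :
    |Pc - X₀ * W| ≤ E * (X₀ * W) := by
  have hL0 : 0 < L := by linarith
  have hL₂0 : 0 < L₂ := by linarith
  have hxr0 : 0 < xr := by
    have h := hz0
    rw [hz] at h
    exact (div_pos_iff_of_pos_right hL₂0).1 h
  have hX₀0 : 0 ≤ X₀ := by
    rw [hX₀]
    exact div_nonneg (by linarith [div_nonneg hz0.le hL0.le]) hL0.le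
  have hM0 : 0 ≤ X₀ * W := mul_nonneg hX₀0 hW0
  have hE0 : 0 < E := lt_of_lt_of_le (by positivity) hEL
  -- `0 ≤ X ≤ (5/4) X₀`
  have hXup : X ≤ 5 / 4 * X₀ := by
    have h1 := (abs_le.1 hX).2
    have h2 : E / 4 * X₀ ≤ 1 / 4 * X₀ := by
      apply mul_le_mul_of_nonneg_right _ hX₀0
      linarith
    linarith
  -- the fundamental-lemma main error
  have hT1 : C_FL * X * W * es ≤ E / 4 * (X₀ * W) := by
    have h1 : C_FL * X * W * es ≤ C_FL * (5 / 4 * X₀) * W * es := by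
      apply mul_le_mul_of_nonneg_right _ hes
      apply mul_le_mul_of_nonneg_right _ hW0
      exact mul_le_mul_of_nonneg_left hXup hCFL
    have h2 : C_FL * (5 / 4 * X₀) * W * es = (5 * C_FL * es) / 4 * (X₀ * W) := by ring
    have h3 : (5 * C_FL * es) / 4 * (X₀ * W) ≤ E / 4 * (X₀ * W) := by
      apply mul_le_mul_of_nonneg_right _ hM0
      linarith
    linarith
  -- the main-term error
  have hT2 : |X * W - X₀ * W| ≤ E / 4 * (X₀ * W) := by
    rw [← sub_mul, abs_mul, abs_of_nonneg hW0]
    calc |X - X₀| * W ≤ E / 4 * X₀ * W := mul_le_mul_of_nonneg_right hX hW0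
      _ = E / 4 * (X₀ * W) := by ring
  -- the remainder
  have hlNz0 : 0 < lNz := by linarith
  have hNV' : NV ≤ xr * L ^ 2 := hNV.trans hVhi
  have hzx : zr ≤ xr := by rw [hz]; exact div_le_self hxr0.le hL₂
  have hNz' : Nz ≤ xr * L ^ 2 := by
    have : xr ≤ xr * L ^ 2 := le_mul_of_one_le_right hxr0.le (by nlinarith)
    linarith
  have hden : (L / 2) ^ 8 ≤ lNz ^ 8 := pow_le_pow_left₀ (by linarith) hlNz 8
  have hden' : (L / 2) ^ 8 ≤ lNV ^ 8 := pow_le_pow_left₀ (by linarith) (hlNz.trans hlNV) 8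
  have hd0 : 0 < (L / 2) ^ 8 := by positivity
  have hSV' : SV ≤ C_BV * (xr * L ^ 2) / (L / 2) ^ 8 :=
    hSV.trans (div_le_div₀ (by positivity) (mul_le_mul_of_nonneg_left hNV' hCBV) hd0 hden')
  have hSz' : Sz ≤ C_BV * (xr * L ^ 2) / (L / 2) ^ 8 :=
    hSz.trans (div_le_div₀ (by positivity) (mul_le_mul_of_nonneg_left hNz' hCBV) hd0 hden)
  have hRle : R ≤ 512 * C_BV * xr / L ^ 6 := by
    have h1 : C_BV * (xr * L ^ 2) / (L / 2) ^ 8 = 256 * C_BV * xr / L ^ 6 := by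
      field_simp
      ring
    have h2 : (512 : ℝ) * C_BV * xr / L ^ 6 = 2 * (256 * C_BV * xr / L ^ 6) := by ring
    linarith [hR, hSV', hSz']
  -- the main term from below
  have hX₀lo : zr / L ^ 2 ≤ X₀ := by
    rw [hX₀, div_le_div_iff₀ (by positivity) hL0]
    have h1 : zr / L ≤ V - zr := by linarith
    have h2 := mul_le_mul_of_nonneg_right h1 (by positivity : (0 : ℝ) ≤ L ^ 2)
    calc zr * L = zr / L * L ^ 2 := by field_simp
      _ ≤ (V - zr) * L ^ 2 := h2
  have hMlo : xr / (4 * L₂ * L ^ 4) ≤ X₀ * W := by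
    have h1 : zr / L ^ 2 * (1 / (4 * L ^ 2)) ≤ X₀ * W :=
      mul_le_mul hX₀lo hW (by positivity) hX₀0
    have h2 : zr / L ^ 2 * (1 / (4 * L ^ 2)) = xr / (4 * L₂ * L ^ 4) := by
      rw [hz]
      field_simp
    linarith
  have hEMlo : xr / (4 * L₂ * L ^ 5) ≤ E * (X₀ * W) := by
    have h1 : 1 / L * (xr / (4 * L₂ * L ^ 4)) ≤ E * (X₀ * W) :=
      mul_le_mul hEL hMlo (by positivity) hE0.le
    have h2 : 1 / L * (xr / (4 * L₂ * L ^ 4)) = xr / (4 * L₂ * L ^ 5) := by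
      field_simp
    linarith
  have hT3 : R ≤ E / 2 * (X₀ * W) := by
    have key : 512 * C_BV * xr / L ^ 6 ≤ 1 / 2 * (xr / (4 * L₂ * L ^ 5)) := by
      rw [show 1 / 2 * (xr / (4 * L₂ * L ^ 5)) = xr * L / (8 * L₂ * L ^ 6) by field_simp; ring,
        div_le_div_iff₀ (by positivity) (by positivity)]
      have h := mul_le_mul_of_nonneg_right hBVnum (by positivity : (0 : ℝ) ≤ xr * L ^ 5 * L ^ 6)
      calc 512 * C_BV * xr * (8 * L₂ * L ^ 6) = 4096 * C_BV * L₂ * (xr * L ^ 5 * L ^ 6) / L ^ 5 := by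
            field_simp
            ring
        _ ≤ L * (xr * L ^ 5 * L ^ 6) / L ^ 5 := div_le_div_of_nonneg_right h (by positivity)
        _ = xr * L * L ^ 6 := by
            field_simp
    have h2 : 1 / 2 * (xr / (4 * L₂ * L ^ 5)) ≤ E / 2 * (X₀ * W) := by linarith [hEMlo]
    linarith
  calc |Pc - X₀ * W| ≤ |Pc - X * W| + |X * W - X₀ * W| := abs_sub_le _ _ _
    _ ≤ (C_FL * X * W * es + R) + E / 4 * (X₀ * W) := add_le_add hFLA hT2
    _ ≤ E / 4 * (X₀ * W) + E / 2 * (X₀ * W) + E / 4 * (X₀ * W) := by linarith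
    _ = E * (X₀ * W) := by ring

/-! ### Lemma 3 for even `m`, with explicit inputs -/

/-- **Lemma 3 for even `m` at one `x`, the three inputs as hypotheses**: the fundamental lemma with
constant `C_FL` at dimension `1` (constant `K₁` of `g_2`), Bombieri–Vinogradov at both heights
`⌊z⌋ ≤ N` with constant `C_BV`, the prime number theorem for `#{z < p ≤ V}`, and the growth facts
of the parameters; conclusion: the estimate of Lemma 3 with `K = 1`. [cite: Maynard2016LargeGaps, Lemma 3] -/
theorem lemma3_core {ε : ℝ} {x : ℕ} {V : ℝ} {m : ℕ} {C_FL K₁ C_BV : ℝ}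
    (hCFL : 0 ≤ C_FL)
    (hFL : ∀ A : SieveSequence, HasSieveDimension A.density 1 K₁ →
      ∀ x z D : ℝ, 2 ≤ z → z ≤ D → 0 ≤ A.size x →
        |A.sifted x (primesProdBelow z) - A.size x * A.densityProduct (primesProdBelow z)| ≤
          C_FL * A.size x * A.densityProduct (primesProdBelow z) *
              Real.exp (-(Real.log D / Real.log z)) +
            ∑ d ∈ (primesProdBelow z).divisors.filter (fun d : ℕ => (d : ℝ) ≤ D), |A.remainder d x|)
    (hK₁ : HasSieveDimension (shiftedPrimesDensity 2) 1 K₁)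
    (hCBV : 0 ≤ C_BV)
    (hBV : ∀ N : ℕ, ⌊z x⌋₊ ≤ N → ∀ a : (q : ℕ) → (ZMod q)ˣ,
      ∑ q ∈ Finset.Icc 1 ⌊(N : ℝ) ^ ((1 : ℝ) / 4)⌋₊, |primeCountingDisc q (a q : ZMod q) N| ≤
        C_BV * N / Real.log N ^ 8)
    (hm1 : 1 ≤ m) (hm : Even m)
    (hX : |((((Finset.Ioc ⌊z x⌋₊ ⌊V⌋₊).filter Nat.Prime).card : ℝ)) - (V - z x) / Real.log x| ≤
        Real.exp (-(Real.log (Real.log x)) ^ ((1 : ℝ) / 2)) / 4 * ((V - z x) / Real.log x))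
    (hVlo : z x + z x / Real.log x ≤ V) (hVhi : V ≤ (x : ℝ) * Real.log x ^ 2)
    (hL : 1 ≤ Real.log x) (hL₂ : 1 ≤ Real.log (Real.log x)) (hz2 : 2 ≤ z x)
    (hY48 : Real.exp 48 ≤ (⌊y ε x⌋₊ : ℝ)) (hlogY : Real.log (⌊y ε x⌋₊ : ℝ) ≤ Real.log x)
    (hzsD : ((⌊y ε x⌋₊ + 1 : ℕ) : ℝ) ≤ (⌊z x⌋₊ : ℝ) ^ ((1 : ℝ) / 4))
    (hFLexp : 5 * C_FL * Real.exp (-(Real.log ((⌊z x⌋₊ : ℝ) ^ ((1 : ℝ) / 4)) /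
        Real.log ((⌊y ε x⌋₊ + 1 : ℕ) : ℝ))) ≤ Real.exp (-(Real.log (Real.log x)) ^ ((1 : ℝ) / 2)))
    (hlogNz : Real.log x / 2 ≤ Real.log (⌊z x⌋₊ : ℝ))
    (hBVnum : 4096 * C_BV * Real.log (Real.log x) ≤ Real.log x) :
    |((sievedPrimes ε x V m).card : ℝ) - (V - z x) / Real.log x * singProd ε x m| ≤
      Real.exp (-(Real.log (Real.log x)) ^ ((1 : ℝ) / 2)) *
        ((V - z x) / Real.log x * singProd ε x m) := by
  have hL0 : 0 < Real.log x := by linarith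
  have hL₂0 : 0 ≤ Real.log (Real.log x) := by linarith
  have hz0 : 0 < z x := by linarith
  have hzV : z x ≤ V := le_trans (le_add_of_nonneg_right (div_nonneg hz0.le hL0.le)) hVlo
  have hV0 : 0 ≤ V := hz0.le.trans hzV
  have hNzV : ⌊z x⌋₊ ≤ ⌊V⌋₊ := Nat.floor_le_floor hzV
  have hNz2 : (2 : ℝ) ≤ (⌊z x⌋₊ : ℝ) := by
    have : (2 : ℕ) ≤ ⌊z x⌋₊ := Nat.le_floor (by exact_mod_cast hz2)
    exact_mod_cast this
  have hNz0 : (0 : ℝ) < (⌊z x⌋₊ : ℝ) := by linarith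
  have hNzle : (⌊z x⌋₊ : ℝ) ≤ z x := Nat.floor_le hz0.le
  have hNVle : (⌊V⌋₊ : ℝ) ≤ V := Nat.floor_le hV0
  have hNzNV : (⌊z x⌋₊ : ℝ) ≤ (⌊V⌋₊ : ℝ) := by exact_mod_cast hNzV
  have hE1 : Real.exp (-(Real.log (Real.log x)) ^ ((1 : ℝ) / 2)) ≤ 1 :=
    Real.exp_le_one_iff.2 (neg_nonpos.2 (Real.rpow_nonneg hL₂0 _))
  have hEL : 1 / Real.log x ≤ Real.exp (-(Real.log (Real.log x)) ^ ((1 : ℝ) / 2)) := by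
    have h1 : (Real.log (Real.log x)) ^ ((1 : ℝ) / 2) ≤ Real.log (Real.log x) := by
      calc (Real.log (Real.log x)) ^ ((1 : ℝ) / 2) ≤ (Real.log (Real.log x)) ^ (1 : ℝ) :=
            Real.rpow_le_rpow_of_exponent_le hL₂ (by norm_num)
        _ = _ := Real.rpow_one _
    calc 1 / Real.log x = Real.exp (-Real.log (Real.log x)) := by
          rw [Real.exp_neg, Real.exp_log hL0, one_div]
      _ ≤ _ := Real.exp_le_exp.2 (by linarith)
  -- `W = 𝔖_y(m) ≥ P_y ≥ 1/(4 log² y) ≥ 1/(4 log² x)`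
  have hlogY48 : 48 ≤ Real.log (⌊y ε x⌋₊ : ℝ) := by
    have := Real.log_le_log (Real.exp_pos 48) hY48
    rwa [Real.log_exp] at this
  have hW : 1 / (4 * Real.log x ^ 2) ≤ singProd ε x m := by
    refine le_trans ?_ ((oddPrimeProd_ge hY48).trans (oddPrimeProd_le_singProd ε x hm))
    apply div_le_div_of_nonneg_left (by norm_num) (by positivity)
    have := pow_le_pow_left₀ (by linarith : 0 ≤ Real.log (⌊y ε x⌋₊ : ℝ)) hlogY 2
    linarith
  -- the fundamental lemma for `𝒜`
  have hdim : HasSieveDimension (lemma3Seq m ⌊z x⌋₊ ⌊V⌋₊).density 1 K₁ :=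
    hasSieveDimension_shiftedPrimesDensity_of_even hK₁ hm
  have hY1 : (1 : ℝ) ≤ (⌊y ε x⌋₊ : ℝ) :=
    le_trans (by have := Real.add_one_le_exp (48 : ℝ); linarith) hY48
  have h2zs : (2 : ℝ) ≤ ((⌊y ε x⌋₊ + 1 : ℕ) : ℝ) := by push_cast; linarith
  have hsize : (0 : ℝ) ≤ (lemma3Seq m ⌊z x⌋₊ ⌊V⌋₊).size ((m * ⌊V⌋₊ : ℕ) : ℝ) := Nat.cast_nonneg _
  have hFLA := hFL (lemma3Seq m ⌊z x⌋₊ ⌊V⌋₊) hdim ((m * ⌊V⌋₊ : ℕ) : ℝ) ((⌊y ε x⌋₊ + 1 : ℕ) : ℝ)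
    ((⌊z x⌋₊ : ℝ) ^ ((1 : ℝ) / 4)) h2zs hzsD hsize
  rw [primesProdBelow_natCast_add_one, ← card_sievedPrimes_eq ε x V hm1,
    densityProduct_lemma3Seq_eq] at hFLA
  change |((sievedPrimes ε x V m).card : ℝ) -
      ((((Finset.Ioc ⌊z x⌋₊ ⌊V⌋₊).filter Nat.Prime).card : ℝ)) * singProd ε x m| ≤
      C_FL * ((((Finset.Ioc ⌊z x⌋₊ ⌊V⌋₊).filter Nat.Prime).card : ℝ)) * singProd ε x m *
          Real.exp (-(Real.log ((⌊z x⌋₊ : ℝ) ^ ((1 : ℝ) / 4)) /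
            Real.log ((⌊y ε x⌋₊ + 1 : ℕ) : ℝ))) +
        ∑ d ∈ (primorial ⌊y ε x⌋₊).divisors.filter
            (fun d : ℕ => (d : ℝ) ≤ (⌊z x⌋₊ : ℝ) ^ ((1 : ℝ) / 4)),
          |(lemma3Seq m ⌊z x⌋₊ ⌊V⌋₊).remainder d ((m * ⌊V⌋₊ : ℕ) : ℝ)| at hFLA
  -- the remainder sum: two Bombieri–Vinogradov sums
  have hR := remainderSum_lemma3Seq_le hm1 hNzV (primorial ⌊y ε x⌋₊) ((⌊z x⌋₊ : ℝ) ^ ((1 : ℝ) / 4))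
  have hSV : ∑ d ∈ Finset.Icc 1 ⌊(⌊z x⌋₊ : ℝ) ^ ((1 : ℝ) / 4)⌋₊,
      |primeCountingDisc d (lemma3Residue m d : ZMod d) ⌊V⌋₊| ≤
        C_BV * (⌊V⌋₊ : ℕ) / Real.log (⌊V⌋₊ : ℕ) ^ 8 := by
    refine le_trans (Finset.sum_le_sum_of_subset_of_nonneg (Finset.Icc_subset_Icc le_rfl
      (Nat.floor_le_floor (Real.rpow_le_rpow hNz0.le hNzNV (by norm_num))))
        fun d _ _ => abs_nonneg _) ?_
    exact hBV ⌊V⌋₊ hNzV (lemma3Residue m)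
  have hSz : ∑ d ∈ Finset.Icc 1 ⌊(⌊z x⌋₊ : ℝ) ^ ((1 : ℝ) / 4)⌋₊,
      |primeCountingDisc d (lemma3Residue m d : ZMod d) ⌊z x⌋₊| ≤
        C_BV * (⌊z x⌋₊ : ℕ) / Real.log (⌊z x⌋₊ : ℕ) ^ 8 :=
    hBV ⌊z x⌋₊ le_rfl (lemma3Residue m)
  -- combine
  exact lemma3_numeric hFLA hR hSV hSz hX rfl hVlo hVhi (singProd_nonneg ε x m) hW hCFL
    (Real.exp_pos _).le hFLexp hE1 hEL hL hL₂ rfl hz0 hNVle hNzle hlogNz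
    (Real.log_le_log hNz0 hNzNV) hCBV hBVnum

/-! ### Growth of the parameters -/

/-- The pure growth facts in `X`: `log X ≥ 100`, `log₂ X ≥ 4`, `log₃ X ≥ 1`, `log₂ X ≤ log X/100`,
`log₃ X ≤ √(log₂ X)/32`, `log₂ X ≥ c²`, `2^{12} C log₂ X ≤ log X`, `√X ≥ 2N`. [folklore] -/
private theorem eventually_logs₃ (c C N : ℝ) :
    ∀ᶠ X : ℝ in atTop,
      100 ≤ Real.log X ∧ 4 ≤ Real.log (Real.log X) ∧ 1 ≤ Real.log (Real.log (Real.log X)) ∧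
      Real.log (Real.log X) ≤ Real.log X / 100 ∧
      Real.log (Real.log (Real.log X)) ≤ Real.sqrt (Real.log (Real.log X)) / 32 ∧
      c ^ 2 ≤ Real.log (Real.log X) ∧
      4096 * C * Real.log (Real.log X) ≤ Real.log X ∧
      N ≤ Real.sqrt X / 2 := by
  have hT₁ : Tendsto (fun X : ℝ => Real.log X) atTop atTop := Real.tendsto_log_atTop
  have hT₂ : Tendsto (fun X : ℝ => Real.log (Real.log X)) atTop atTop :=
    Real.tendsto_log_atTop.comp hT₁
  have hT₃ : Tendsto (fun X : ℝ => Real.log (Real.log (Real.log X))) atTop atTop :=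
    Real.tendsto_log_atTop.comp hT₂
  have hlin₁ := hT₁.eventually
    (Real.isLittleO_log_id_atTop.bound (show (0 : ℝ) < 1 / 100 by norm_num))
  have hδ : (0 : ℝ) < 1 / (4096 * (|C| + 1)) := by positivity
  have hlin₂ := hT₁.eventually (Real.isLittleO_log_id_atTop.bound hδ)
  have hlin₃ := hT₂.eventually
    ((isLittleO_log_rpow_atTop (show (0 : ℝ) < 1 / 2 by norm_num)).bound
      (show (0 : ℝ) < 1 / 32 by norm_num))
  filter_upwards [hT₁.eventually_ge_atTop 100, hT₂.eventually_ge_atTop 4,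
    hT₃.eventually_ge_atTop 1, hT₂.eventually_ge_atTop (c ^ 2), hlin₁, hlin₂, hlin₃,
    eventually_ge_atTop ((2 * |N|) ^ 2)] with X hL hL₂ hL₃ hc h₁ h₂ h₃ hN
  have hL0 : 0 < Real.log X := by linarith
  have hL₂0 : 0 < Real.log (Real.log X) := by linarith
  rw [Real.norm_eq_abs, Real.norm_eq_abs, id, abs_of_nonneg hL₂0.le, abs_of_nonneg hL0.le] at h₁ h₂
  rw [Real.norm_eq_abs, Real.norm_eq_abs, abs_of_nonneg (by linarith), abs_of_nonneg
    (Real.rpow_nonneg hL₂0.le _), ← Real.sqrt_eq_rpow] at h₃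
  refine ⟨hL, hL₂, hL₃, by linarith, by linarith, hc, ?_, ?_⟩
  · have h1 : 4096 * C * Real.log (Real.log X) ≤ 4096 * (|C| + 1) * Real.log (Real.log X) := by
      apply mul_le_mul_of_nonneg_right _ hL₂0.le
      linarith [le_abs_self C]
    have h2 : 4096 * (|C| + 1) * Real.log (Real.log X) ≤ Real.log X := by
      have h := mul_le_mul_of_nonneg_left h₂ (by positivity : (0 : ℝ) ≤ 4096 * (|C| + 1))
      have : 4096 * (|C| + 1) * (1 / (4096 * (|C| + 1)) * Real.log X) = Real.log X := by
        field_simp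
      linarith
    linarith
  · have h0 : 0 ≤ 2 * |N| := by positivity
    have hX0 : 0 ≤ X := le_trans (sq_nonneg _) hN
    have h1 : 2 * |N| ≤ Real.sqrt X := (Real.le_sqrt h0 hX0).2 hN
    linarith [le_abs_self N]

/-- The parameter `y`: for `0 < ε < 1/2` and the growth facts, `⌊y⌋ ≥ e^{48}` (so `≥ 2`),
`0 < log ⌊y⌋ ≤ log x`, `0 < log(⌊y⌋ + 1) ≤ 1 + log x log₃ x/log₂ x`. [folklore] -/
private theorem y_facts₃ {ε : ℝ} {x : ℕ} (hε0 : 0 < ε) (hε : ε < 1 / 2)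
    (hL₂ : 4 ≤ Real.log (Real.log x))
    (hL₃ : 1 ≤ Real.log (Real.log (Real.log x)))
    (h100 : Real.log (Real.log x) ≤ Real.log x / 100) :
    2 ≤ ⌊y ε x⌋₊ ∧ Real.exp 48 ≤ (⌊y ε x⌋₊ : ℝ) ∧ 0 < Real.log (⌊y ε x⌋₊ : ℝ) ∧
      Real.log (⌊y ε x⌋₊ : ℝ) ≤ Real.log x ∧
      0 < Real.log ((⌊y ε x⌋₊ + 1 : ℕ) : ℝ) ∧
      Real.log ((⌊y ε x⌋₊ + 1 : ℕ) : ℝ) ≤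
        1 + Real.log x * Real.log (Real.log (Real.log x)) / Real.log (Real.log x) := by
  have hL0 : 0 < Real.log (x : ℝ) := by linarith
  have hL₂0 : 0 < Real.log (Real.log (x : ℝ)) := by linarith
  have hL₃le : Real.log (Real.log (Real.log (x : ℝ))) ≤ Real.log (Real.log x) :=
    (Real.log_le_sub_one_of_pos hL₂0).trans (by linarith)
  set T := Real.log (x : ℝ) * Real.log (Real.log (Real.log x)) / Real.log (Real.log x) with hT
  have hT100 : 100 ≤ T := by
    rw [hT, le_div_iff₀ hL₂0]
    have h1 : 100 * Real.log (Real.log (x : ℝ)) ≤ Real.log x := by linarith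
    calc 100 * Real.log (Real.log (x : ℝ)) ≤ Real.log x := h1
      _ ≤ Real.log x * Real.log (Real.log (Real.log x)) := le_mul_of_one_le_right hL0.le hL₃
  have hTle : T ≤ Real.log x := by
    rw [hT, div_le_iff₀ hL₂0]
    exact mul_le_mul_of_nonneg_left hL₃le hL0.le
  have hT0 : 0 ≤ T := by linarith
  have hly : Real.log (y ε x) = (1 - ε) * T := by rw [log_y]
  have hly50 : 50 ≤ Real.log (y ε x) := by rw [hly]; nlinarith
  have hlyL : Real.log (y ε x) ≤ T := by rw [hly]; nlinarith
  have hy0 : 0 < y ε x := Real.exp_pos _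
  have hyexp : Real.exp 50 ≤ y ε x := by
    have := Real.exp_le_exp.2 hly50; rwa [Real.exp_log hy0] at this
  have hYfloor : y ε x - 1 < (⌊y ε x⌋₊ : ℝ) := by
    have := Nat.lt_floor_add_one (y ε x); linarith
  have he : 2 * Real.exp 48 + 2 ≤ Real.exp 50 := by
    have h1 : Real.exp 50 = Real.exp 48 * Real.exp 2 := by rw [← Real.exp_add]; norm_num
    have h2 : (3 : ℝ) ≤ Real.exp 2 := by have := Real.add_one_le_exp (2 : ℝ); linarith
    have h3 : (2 : ℝ) ≤ Real.exp 48 := by have := Real.add_one_le_exp (48 : ℝ); linarith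
    nlinarith
  have hY48 : Real.exp 48 ≤ (⌊y ε x⌋₊ : ℝ) := by linarith
  have h48 : (2 : ℝ) ≤ Real.exp 48 := by have := Real.add_one_le_exp (48 : ℝ); linarith
  have hY2r : (2 : ℝ) ≤ (⌊y ε x⌋₊ : ℝ) := h48.trans hY48
  have hY2 : 2 ≤ ⌊y ε x⌋₊ := by exact_mod_cast hY2r
  have hY1 : (1 : ℝ) < ⌊y ε x⌋₊ := by linarith
  have hYle : (⌊y ε x⌋₊ : ℝ) ≤ y ε x := Nat.floor_le hy0.le
  have hlogY : Real.log (⌊y ε x⌋₊ : ℝ) ≤ Real.log (y ε x) := Real.log_le_log (by linarith) hYle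
  have hY1' : (1 : ℝ) < ((⌊y ε x⌋₊ + 1 : ℕ) : ℝ) := by push_cast; linarith
  have hlogY1 : Real.log ((⌊y ε x⌋₊ + 1 : ℕ) : ℝ) ≤ Real.log 2 + Real.log (y ε x) := by
    rw [← Real.log_mul two_ne_zero hy0.ne']
    exact Real.log_le_log (by linarith) (by push_cast; linarith)
  have hlog2 : Real.log 2 < 1 := by have := Real.log_two_lt_d9; linarith
  exact ⟨hY2, hY48, Real.log_pos hY1, hlogY.trans (hlyL.trans hTle), Real.log_pos hY1',
    by linarith⟩

/-- The parameter `z = x/log₂ x`: `z ≥ √x/2 ≥ N₀ + 2`, `log ⌊z⌋ ≥ log x/2`,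
`log(⌊z⌋^{1/4}) ≥ log x/8`. [folklore] -/
private theorem z_facts₃ {x N₀ : ℕ} (hL : 100 ≤ Real.log x) (hL₂ : 4 ≤ Real.log (Real.log x))
    (h100 : Real.log (Real.log x) ≤ Real.log x / 100)
    (hN : (N₀ : ℝ) + 2 ≤ Real.sqrt x / 2) :
    2 ≤ z x ∧ N₀ ≤ ⌊z x⌋₊ ∧ 0 < (⌊z x⌋₊ : ℝ) ∧ Real.log x / 2 ≤ Real.log (⌊z x⌋₊ : ℝ) ∧
      Real.log x / 8 ≤ Real.log ((⌊z x⌋₊ : ℝ) ^ ((1 : ℝ) / 4)) := by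
  have hL0 : 0 < Real.log (x : ℝ) := by linarith
  have hL₂0 : 0 < Real.log (Real.log (x : ℝ)) := by linarith
  have hX0 : 0 < (x : ℝ) := by
    by_contra h
    have hx0 : (x : ℝ) = 0 := le_antisymm (not_lt.1 h) (Nat.cast_nonneg x)
    rw [hx0, Real.log_zero] at hL
    linarith
  have hX1 : 1 < (x : ℝ) := by
    by_contra h
    have := Real.log_nonpos (Nat.cast_nonneg x) (not_lt.1 h)
    linarith
  -- `log x ≤ 2 √x`
  have hsqrt0 : 0 < Real.sqrt x := Real.sqrt_pos.2 hX0
  have hLsqrt : Real.log (x : ℝ) ≤ 2 * Real.sqrt x := by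
    have h1 : Real.log (Real.sqrt x) = Real.log x / 2 := Real.log_sqrt hX0.le
    have h2 := Real.log_le_sub_one_of_pos hsqrt0
    linarith
  -- `z ≥ x/log x ≥ √x/2`
  have hz_def : z x = (x : ℝ) / Real.log (Real.log x) := rfl
  have hz1 : (x : ℝ) / Real.log x ≤ z x := by
    rw [hz_def]
    exact div_le_div_of_nonneg_left hX0.le hL₂0 (by linarith)
  have hz2' : Real.sqrt x / 2 ≤ (x : ℝ) / Real.log x := by
    rw [div_le_div_iff₀ (by norm_num) hL0]
    have hxx : Real.sqrt x * Real.sqrt x = x := Real.mul_self_sqrt hX0.le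
    nlinarith
  have hzN : (N₀ : ℝ) + 2 ≤ z x := hN.trans (hz2'.trans hz1)
  have hz2 : 2 ≤ z x := by linarith [(Nat.cast_nonneg N₀ : (0 : ℝ) ≤ N₀)]
  have hz0 : 0 < z x := by linarith
  have hN₀ : N₀ ≤ ⌊z x⌋₊ := Nat.le_floor (by linarith)
  -- `⌊z⌋ ≥ z/2`, `log ⌊z⌋ ≥ log z − log 2 = log x − log₃ x − log 2 ≥ log x/2`
  have hNz : z x / 2 ≤ (⌊z x⌋₊ : ℝ) := by
    have := Nat.lt_floor_add_one (z x); linarith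
  have hNz0 : 0 < (⌊z x⌋₊ : ℝ) := by linarith
  have hlogz : Real.log (z x) = Real.log x - Real.log (Real.log (Real.log x)) := by
    rw [hz_def, Real.log_div hX0.ne' hL₂0.ne']
  have hL₃le : Real.log (Real.log (Real.log (x : ℝ))) ≤ Real.log (Real.log x) :=
    (Real.log_le_sub_one_of_pos hL₂0).trans (by linarith)
  have hlog2 : Real.log 2 < 1 := by have := Real.log_two_lt_d9; linarith
  have hlogNz : Real.log x / 2 ≤ Real.log (⌊z x⌋₊ : ℝ) := by
    have h1 : Real.log (z x / 2) ≤ Real.log (⌊z x⌋₊ : ℝ) := Real.log_le_log (by linarith) hNz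
    rw [Real.log_div hz0.ne' two_ne_zero, hlogz] at h1
    linarith
  refine ⟨hz2, hN₀, hNz0, hlogNz, ?_⟩
  rw [Real.log_rpow hNz0]
  linarith

/-- The level `D = ⌊z⌋^{1/4}` against the sifting range `y + 1`: `y + 1 ≤ D` and
`5 C e^{−log D/log(y+1)} ≤ e^{−√(log₂ x)}`. [folklore] -/
private theorem level_facts₃ {C_FL L L₂ L₃ lD lzs zs D : ℝ} (hL : 100 ≤ L) (hL₂ : 4 ≤ L₂)
    (hL₃1 : 1 ≤ L₃) (hL₃ : L₃ ≤ Real.sqrt L₂ / 32) (h100 : L₂ ≤ L / 100)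
    (hc : Real.log (5 * C_FL) ^ 2 ≤ L₂)
    (hlD : L / 8 ≤ lD) (hD : Real.log D = lD) (hD0 : 0 < D)
    (hlzs0 : 0 < lzs) (hlzs : lzs ≤ 1 + L * L₃ / L₂) (hzs : Real.log zs = lzs) (hzs0 : 0 < zs) :
    zs ≤ D ∧ 5 * C_FL * Real.exp (-(lD / lzs)) ≤ Real.exp (-L₂ ^ ((1 : ℝ) / 2)) := by
  have hL0 : 0 < L := by linarith
  have hL₂0 : 0 < L₂ := by linarith
  have hL₃0 : 0 ≤ L₃ := by linarith
  have hs0 : 0 ≤ Real.sqrt L₂ := Real.sqrt_nonneg _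
  have hss : Real.sqrt L₂ * Real.sqrt L₂ = L₂ := Real.mul_self_sqrt hL₂0.le
  have hs2 : 2 ≤ Real.sqrt L₂ := by
    rw [show (2 : ℝ) = Real.sqrt 4 by rw [show (4 : ℝ) = 2 ^ 2 by norm_num, Real.sqrt_sq (by norm_num)]]
    exact Real.sqrt_le_sqrt hL₂
  -- `T = L L₃/L₂ ≤ L/128`
  have hL₃' : L₃ ≤ L₂ / 64 := by nlinarith
  have hT : L * L₃ / L₂ ≤ L / 64 := by
    rw [div_le_iff₀ hL₂0]
    have := mul_le_mul_of_nonneg_left hL₃' hL0.le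
    linarith
  have hT0 : 0 ≤ L * L₃ / L₂ := by positivity
  refine ⟨?_, ?_⟩
  · -- `log zs ≤ 1 + L/64 ≤ L/8 ≤ log D`
    rw [← Real.log_le_log_iff hzs0 hD0, hzs, hD]
    linarith
  · by_cases hC : C_FL ≤ 0
    · have h1 : 5 * C_FL * Real.exp (-(lD / lzs)) ≤ 0 :=
        mul_nonpos_of_nonpos_of_nonneg (by linarith) (Real.exp_pos _).le
      linarith [Real.exp_pos (-L₂ ^ ((1 : ℝ) / 2))]
    · have hC0 : 0 < 5 * C_FL := by linarith
      rw [← Real.sqrt_eq_rpow, ← Real.exp_log hC0, ← Real.exp_add, Real.exp_le_exp]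
      -- `log 5C − lD/lzs ≤ −√L₂ ⟸ (√L₂ + log 5C) lzs ≤ lD`
      have habs : |Real.log (5 * C_FL)| ≤ Real.sqrt L₂ := Real.abs_le_sqrt hc
      have hkey : (Real.sqrt L₂ + Real.log (5 * C_FL)) * lzs ≤ lD := by
        have h1 : (Real.sqrt L₂ + Real.log (5 * C_FL)) * lzs ≤
            (Real.sqrt L₂ + |Real.log (5 * C_FL)|) * lzs :=
          mul_le_mul_of_nonneg_right (by linarith [le_abs_self (Real.log (5 * C_FL))]) hlzs0.le
        have h2 : (Real.sqrt L₂ + |Real.log (5 * C_FL)|) * lzs ≤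
            (2 * Real.sqrt L₂) * (2 * (L * L₃ / L₂)) := by
          apply mul_le_mul (by linarith) _ hlzs0.le (by positivity)
          have hT1 : 1 ≤ L * L₃ / L₂ := by
            rw [le_div_iff₀ hL₂0, one_mul]
            calc L₂ ≤ L := by linarith
              _ ≤ L * L₃ := le_mul_of_one_le_right hL0.le hL₃1
          linarith
        have h3 : (2 * Real.sqrt L₂) * (2 * (L * L₃ / L₂)) ≤
            (2 * Real.sqrt L₂) * (2 * (L * (Real.sqrt L₂ / 32) / L₂)) := by
          apply mul_le_mul_of_nonneg_left _ (by positivity)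
          apply mul_le_mul_of_nonneg_left _ (by norm_num)
          exact div_le_div_of_nonneg_right (mul_le_mul_of_nonneg_left hL₃ hL0.le) hL₂0.le
        have h4 : (2 * Real.sqrt L₂) * (2 * (L * (Real.sqrt L₂ / 32) / L₂)) = L / 8 := by
          have : (2 * Real.sqrt L₂) * (2 * (L * (Real.sqrt L₂ / 32) / L₂)) =
              (Real.sqrt L₂ * Real.sqrt L₂) * L / (8 * L₂) := by ring
          rw [this, hss]
          field_simp
        linarith
      have := (le_div_iff₀ hlzs0).2 hkey
      linarith


/-! ### Lemma 3 -/

/-- For odd `m` the singular product `𝔖_y(m)` vanishes (the factor at `p = 2 ∤ m` is `0`), once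
`y ≥ 2`. [cite: Maynard2016LargeGaps, §2 (sentence before (2.6))] -/
theorem singProd_eq_zero_of_odd {ε : ℝ} {x m : ℕ} (hy : 2 ≤ ⌊y ε x⌋₊) (hm : Odd m) :
    singProd ε x m = 0 := by
  unfold singProd
  refine Finset.prod_eq_zero (i := 2) ?_ (by norm_num)
  simp only [Finset.mem_filter, Finset.mem_Iic]
  exact ⟨hy, Nat.prime_two, fun h2 => (Nat.not_even_iff_odd.2 hm) (even_iff_two_dvd.2 h2)⟩

/-- **Maynard 2016, Lemma 3** — PROVED, with `K = 1`: for every `0 < ε < 1/2` and all large `x`,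
uniformly for `z + z/log x ≤ V ≤ x log² x` and `m ≥ 1`,
`|#{z < p ≤ V : (mp − 1, P_y) = 1} − 𝔖_y(m)(V − z)/log x| ≤ e^{−√(log₂ x)} 𝔖_y(m)(V − z)/log x`.
"The lemma now follows from the fundamental lemma … Bombieri–Vinogradov … and the prime number
theorem": all three inputs are PROVED in the tree — the uniform fundamental lemma
`SieveSequence.fundamental_lemma_uniform_holds` with the dimension-`1` bound of `g_2`
(`hasSieveDimension_shiftedPrimes_one_holds`, transferred to every even `m` by
`hasSieveDimension_shiftedPrimesDensity_of_even`), the Bombieri–Vinogradov theorem in `π`-form at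
level `N^{1/4}` (`Chen.eventually_sum_abs_primeCountingDisc_le BombieriVinogradovStatement_holds`),
and the prime number theorem with de la Vallée-Poussin error term (`eventually_card_primes_Ioc`).
For odd `m` both sides vanish. [cite: Maynard2016LargeGaps, Lemma 3] -/
theorem lemma3_holds : Lemma3 := by
  -- the fundamental lemma, uniformly at dimension `1` with the constant of `g_2`
  obtain ⟨K₁, hK₁⟩ := hasSieveDimension_shiftedPrimes_one_holds (h := 2) even_two
  rw [SieveSequence.shiftedPrimes_density] at hK₁
  obtain ⟨C_FL, hCFL, hFL⟩ := SieveSequence.fundamental_lemma_uniform_holds 1 K₁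
  -- Bombieri–Vinogradov in `π`-form at level `N^{1/4}`, saving `(log N)^8`
  obtain ⟨C₀, hC₀⟩ := Chen.eventually_sum_abs_primeCountingDisc_le
    BombieriVinogradovStatement_holds (θ₁ := 1 / 4) (by norm_num) (A := 8) (by norm_num)
  obtain ⟨N₀, hN₀⟩ := Filter.eventually_atTop.1 hC₀
  have hCBV : (0 : ℝ) ≤ max C₀ 1 := le_trans zero_le_one (le_max_right _ _)
  have hBV : ∀ N : ℕ, N₀ ≤ N → ∀ a : (q : ℕ) → (ZMod q)ˣ,
      ∑ q ∈ Finset.Icc 1 ⌊(N : ℝ) ^ ((1 : ℝ) / 4)⌋₊, |primeCountingDisc q (a q : ZMod q) N| ≤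
        max C₀ 1 * N / Real.log N ^ 8 := by
    intro N hN a
    refine (hN₀ N hN a).trans ?_
    rw [show (8 : ℝ) = ((8 : ℕ) : ℝ) by norm_num, Real.rpow_natCast, mul_div_assoc, mul_div_assoc]
    exact mul_le_mul_of_nonneg_right (le_max_left _ _)
      (div_nonneg (Nat.cast_nonneg _) (pow_nonneg (Real.log_natCast_nonneg N) _))
  -- `0 < ε < 1/2`
  have hε : ∀ᶠ ε : ℝ in 𝓝[>] 0, 0 < ε ∧ ε < 1 / 2 := by
    filter_upwards [eventually_nhdsWithin_of_forall (s := Set.Ioi (0 : ℝ)) (fun ε hε => hε),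
      (eventually_lt_nhds (show (0 : ℝ) < 1 / 2 by norm_num)).filter_mono nhdsWithin_le_nhds]
      with ε h1 h2
    exact ⟨h1, h2⟩
  filter_upwards [hε] with ε hε
  refine ⟨1, one_pos, ?_⟩
  filter_upwards [eventually_card_primes_Ioc, tendsto_natCast_atTop_atTop.eventually
    (eventually_logs₃ (Real.log (5 * C_FL)) (max C₀ 1) ((N₀ : ℝ) + 2))] with x hxV hg
  obtain ⟨hL, hL₂, hL₃, h100, hL₃s, hc, hBVnum, hN⟩ := hg
  intro V hVlo hVhi m hm1 _hmx
  obtain ⟨hY2, hY48, -, hlogY, hlogY10, hlogY1⟩ := y_facts₃ hε.1 hε.2 hL₂ hL₃ h100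
  obtain ⟨hz2, hN₀z, hNz0, hlogNz, hlD⟩ := z_facts₃ hL hL₂ h100 hN
  rcases Nat.even_or_odd m with hm | hm
  · obtain ⟨hzsD, hFLexp⟩ := level_facts₃ (C_FL := C_FL) hL hL₂ hL₃ hL₃s h100 hc hlD rfl
      (Real.rpow_pos_of_pos hNz0 _) hlogY10 hlogY1 rfl (by positivity)
    rw [one_mul]
    exact lemma3_core hCFL.le hFL hK₁ hCBV (fun N hN a => hBV N (hN₀z.trans hN) a) hm1 hm
      (hxV V hVlo hVhi) hVlo hVhi (by linarith) (by linarith) hz2 hY48 hlogY hzsD hFLexp hlogNz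
      hBVnum
  · rw [sievedPrimes_eq_empty_of_odd hY2 hz2 hm, singProd_eq_zero_of_odd hY2 hm]
    simp

/-! ### Corollaries: Lemma 3 discharged from the conditional reductions -/

/-- **Proposition 5′ ⇒ Proposition 5**, Lemma 3 and the prime number theorem discharged.
[cite: Maynard2016LargeGaps, §3 (first paragraph)] -/
theorem proposition5_of_proposition5Prime' (h5 : Proposition5Prime) : Proposition5 :=
  proposition5_of_proposition5Prime h5 lemma3_holds

/-- **Maynard 2016, Theorem 1 from Lemma 2 and the GPY measures of §4** — Lemma 3, §2–§3 and
the prime number theorem PROVED in the tree. [cite: Maynard2016LargeGaps, Thm 1] -/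
theorem theorem1_of_lemma2_GPY (h₂ : Lemma2) (hμ : GPYMeasures) :
    Literature.NumberTheory.Sieve.Maynard2016_theorem1 :=
  theorem1_of_GPY h₂ lemma3_holds hμ

/-- … hence Rankin's bound with an arbitrary constant `c`, from Lemma 2 and the GPY measures.
[cite: Maynard2016LargeGaps, Thm 1] -/
theorem forall_rankinConstant_of_lemma2_GPY (h₂ : Lemma2) (hμ : GPYMeasures) (c : ℝ) :
    Literature.NumberTheory.Sieve.RankinConstant c :=
  forall_rankinConstant_of_GPY h₂ lemma3_holds hμ c

end Maynard2016

end Literature.NumberTheory.Sieve
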